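import Mathlib.Algebra.FreeAlgebra
import Mathlib.Data.Complex.Basic
import Mathlib.Algebra.Algebra.Tower
import Mathlib.Algebra.Lie.OfAssociative
import Mathlib.LinearAlgebra.Quotient.Basic
import Mathlib.LinearAlgebra.Eigenspace.Basic
import Mathlib.LinearAlgebra.Dimension.Finrank
import Mathlib.Combinatorics.Enumerative.Partition.Basic
import HarnessLib

/-!
# Representations of the Virasoro algebra (plain, non-unitary): weight spaces, primary vectors,
# subrepresentations and quotients, PBW words

The Virasoro algebra `Vir = ⊕_{n ∈ ℤ} ℂ L_n ⊕ ℂ C` has brackets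
`[L_m, L_n] = (m - n) L_{m+n} + (1/12)(m³ - m) δ_{m+n,0} C`, `[Vir, C] = 0`
(Iohara–Koga, *Representation Theory of the Virasoro Algebra*, Definition 1.2; Kytölä–Ridout,
*On staggered indecomposable Virasoro modules*, eq. (2.1); Di Francesco–Mathieu–Sénéchal (7.4)).
On every module considered in the literature served here `C` acts as a scalar `c`, the central
charge, i.e. one works with modules over `U = U(Vir)/(C - c·1)` (Kytölä–Ridout §2). Such a module
is exactly a complex vector space `V` with endomorphisms `L_n` satisfying the relations with `C`
replaced by `c` (the Jacobi identity being automatic for commutators of operators); this is the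
structure `VirasoroRep c V` below — the PLAIN notion: no inner product, no hermiticity, no
grading and no diagonalisability of `L_0` are assumed, so that the non-unitary, reducible but
indecomposable and logarithmic (`L_0` with Jordan blocks) modules of `c = 0` conformal field theory
are instances. (The structure `Literature.Barriers.CriticalPhenomena.UnitaryCFT.UnitaryVirasoroRep`
of the barrier catalogue is the same data on an inner-product space plus `L_n† = L_{-n}`; at `c = 0`
it only has trivial highest-weight vectors, by the proved barrier `SAWNoUnitaryCFT`.)

## Contents (namespace `Literature.RepresentationTheory.Virasoro`)

* `centralTerm c m n = (c/12)(m³ - m) δ_{m+n,0}`; `VirasoroRep c V` and the relations as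
  `comm_apply`, `bracket` (commutator form in `End V`), `L_zero_apply_L` (`[L_0, L_n] = -n L_n`);
* `L_n` lowers the `L_0`-weight by `n`, for eigenvectors (`apply_mem_eigenspace`) AND for
  generalised eigenvectors (`apply_mem_maxGenEigenspace`, via `semiconjBy_L`), the grading used for
  staggered modules (Kytölä–Ridout §3);
* `weightSpace`, `genWeightSpace`, `gradedDim` (coefficient of the character `Tr q^{L_0}`,
  DMS (7.12));
* `IsPrimary v h` (`L_n v = 0` for `n > 0`, `L_0 v = h v`; DMS (7.5)–(7.6)), with (7.19)
  `L_n L_{-n} v = (2nh + (c/12)(n³ - n)) v` proved (`IsPrimary.L_pos_L_neg`); `IsSingularVector`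
  (Iohara–Koga Def. 5.3); `IsHighestWeightModule` (Iohara–Koga Def. 1.16);
* invariant subspaces `IsInvariant`, the generated subrepresentation `generated s` (least invariant
  subspace containing `s`, with `subset_generated`, `isInvariant_generated`, `generated_le`),
  `primarySpan μ` (generated by the primary vectors of weight `μ`), the restricted and quotient
  representations `restrict`, `quotient` (`quotient_L_mk`, `IsPrimary.mkQ`);
* `IsWeightModule` (`L_0` diagonalisable), `IsIndecomposable`, and the rank-two staggered modules
  `IsStaggered` of Kytölä–Ridout §3 (indecomposable, left/right highest-weight modules, `L_0` not
  diagonalisable with Jordan cells of rank ≤ 2) — as predicates only;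
* PBW words `pbwVector [k₁,…,k_j] v = L_{-k₁} ⋯ L_{-k_j} v` and `partitionVector 𝕀 v` for a
  partition `𝕀 ⊢ N` (Iohara–Koga (4.17)), with the weight count `e_𝕀 v ∈ V_{μ+N}` (DMS (7.8)).

Verma modules `V(c,h)`, their universal property, the Kac table `h_{r,s}(t)` and the Kac quotients
`K_{r,s}` are in `Literature.RepresentationTheory.Virasoro.VermaModule`; the `c = 0`
specialisation (`VirasoroModuleC0`, the polymer modules `𝒱_k = K_{k+1,1}` with
`h = 0, 5/8, 2, 33/8, …`) in `Literature.RepresentationTheory.Virasoro.CentralChargeZero`.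

## Not here

The Virasoro algebra as a Mathlib `LieAlgebra` (Mathlib has no Virasoro/Witt algebra at the pinned
version; the operator form is what the consumers — lattice Virasoro modes, Koo–Saleur limits —
use), the Shapovalov form and the Kac determinant, the structure theory of staggered modules and
their β-invariants / logarithmic couplings (Kytölä–Ridout §3, §6.5; Gurarie–Ludwig's `b`),
characters as `q`-series.
-/

noncomputable section

namespace Literature.RepresentationTheory.Virasoro

/-- The central term `(c/12)(m³ - m) δ_{m+n,0}` of the Virasoro commutation relations
`[L_m, L_n] = (m - n) L_{m+n} + (c/12)(m³ - m) δ_{m+n,0}`.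
[cite: IoharaKoga2011, Definition 1.2] -/
def centralTerm (c : ℂ) (m n : ℤ) : ℂ :=
  if m + n = 0 then c / 12 * ((m : ℂ) ^ 3 - m) else 0

/-- A **representation of the Virasoro algebra with central charge `c`** on a complex vector space
`V` (no inner product, no grading assumed): endomorphisms `L n`, `n ∈ ℤ`, with
`L_m L_n x - L_n L_m x = (m - n) L_{m+n} x + (c/12)(m³ - m) δ_{m+n,0} x`, i.e. a module over the
Virasoro algebra `Vir = ⊕ ℂLₙ ⊕ ℂC` on which the central element `C` acts as the scalar `c`
(equivalently a module over `U = U(Vir)/(C - c1)`). [cite: IoharaKoga2011, Definition 1.2]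
[cite: KytolaRidout2009, §2 eq. (2.1)] -/
structure VirasoroRep (c : ℂ) (V : Type*) [AddCommGroup V] [Module ℂ V] where
  /-- The Virasoro generators `L_n`, `n ∈ ℤ`, as endomorphisms of `V`. -/
  L : ℤ → Module.End ℂ V
  /-- `L_m (L_n x) - L_n (L_m x) = (m - n) L_{m+n} x + (c/12)(m³ - m) δ_{m+n,0} x`. -/
  lie : ∀ (m n : ℤ) (x : V),
    L m (L n x) - L n (L m x) = ((m : ℂ) - n) • L (m + n) x + centralTerm c m n • x

/-! ### The central term -/

/-- Off the anti-diagonal the central term vanishes. [folklore] -/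
theorem centralTerm_of_ne (c : ℂ) {m n : ℤ} (h : m + n ≠ 0) : centralTerm c m n = 0 := if_neg h

/-- At central charge `0` the central term vanishes identically. [folklore] -/
@[simp] theorem centralTerm_zero (m n : ℤ) : centralTerm 0 m n = 0 := by
  simp [centralTerm]

/-- `L_0` has no central term with anybody. [folklore] -/
@[simp] theorem centralTerm_zero_left (c : ℂ) (n : ℤ) : centralTerm c 0 n = 0 := by
  simp [centralTerm]

/-- `L_1` has no central term with anybody (`1³ - 1 = 0`). [folklore] -/
theorem centralTerm_one_left (c : ℂ) (n : ℤ) : centralTerm c 1 n = 0 := by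
  simp [centralTerm]

/-- `L_{-1}` has no central term with anybody (`(-1)³ + 1 = 0`); with `centralTerm_zero_left` and
`centralTerm_one_left`: `L_0, L_{±1}` span a centreless `sl₂`. [folklore] -/
theorem centralTerm_neg_one_left (c : ℂ) (n : ℤ) : centralTerm c (-1) n = 0 := by
  norm_num [centralTerm]

/-- The central term of `[L_n, L_{-n}]` is `(c/12)(n³ - n)`. [cite: IoharaKoga2011, Definition 1.2] -/
theorem centralTerm_self_neg (c : ℂ) (n : ℤ) :
    centralTerm c n (-n) = c / 12 * ((n : ℂ) ^ 3 - n) := by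
  simp [centralTerm]

namespace VirasoroRep

variable {c : ℂ} {V : Type*} [AddCommGroup V] [Module ℂ V] (R : VirasoroRep c V)

/-- The relation solved for `L_m L_n x`. [cite: IoharaKoga2011, Definition 1.2] -/
theorem comm_apply (m n : ℤ) (x : V) :
    R.L m (R.L n x) = R.L n (R.L m x) + ((m : ℂ) - n) • R.L (m + n) x + centralTerm c m n • x := by
  have := R.lie m n x
  rw [sub_eq_iff_eq_add] at this
  rw [this]; abel

/-- The relations as a commutator identity in the associative algebra `End V` (with its commutator
bracket): `⁅L_m, L_n⁆ = (m - n) L_{m+n} + (c/12)(m³ - m) δ_{m+n,0} · 1`.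
[cite: KytolaRidout2009, §2 eq. (2.1)] -/
theorem bracket (m n : ℤ) :
    ⁅R.L m, R.L n⁆ = ((m : ℂ) - n) • R.L (m + n) + centralTerm c m n • (1 : Module.End ℂ V) := by
  ext x
  simp only [Ring.lie_def, LinearMap.sub_apply, Module.End.mul_apply, LinearMap.add_apply,
    LinearMap.smul_apply, Module.End.one_apply]
  exact R.lie m n x

/-- `L_0 L_n x = L_n L_0 x - n L_n x` (`[L_0, L_n] = -n L_n`: "the index and the grade are opposite
one another"). [cite: KytolaRidout2009, §2 (after eq. (2.3))] -/
theorem L_zero_apply_L (n : ℤ) (x : V) :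
    R.L 0 (R.L n x) = R.L n (R.L 0 x) - (n : ℂ) • R.L n x := by
  rw [R.comm_apply 0 n x, centralTerm_zero_left, zero_smul, add_zero, zero_add, Int.cast_zero,
    zero_sub, neg_smul, sub_eq_add_neg]

/-- `L_n` maps the `L_0`-eigenspace of eigenvalue `μ` into that of eigenvalue `μ - n`.
[cite: KytolaRidout2009, §2 (after eq. (2.6): "Lₙ ∈ U₋ₙ")] -/
theorem apply_mem_eigenspace {μ : ℂ} {x : V} (hx : x ∈ (R.L 0).eigenspace μ) (n : ℤ) :
    R.L n x ∈ (R.L 0).eigenspace (μ - n) := by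
  rw [Module.End.mem_eigenspace_iff] at hx ⊢
  rw [R.L_zero_apply_L, hx, map_smul, sub_smul]

/-- `L_n (L_0 - μ) = (L_0 - (μ - n)) L_n` in `End V`. [cite: KytolaRidout2009, §3 ("Lₘ maps the L₀ᵈ eigenspace of eigenvalue h to that of eigenvalue h - m")] -/
theorem semiconjBy_L (n : ℤ) (μ : ℂ) :
    SemiconjBy (R.L n) (R.L 0 - μ • 1) (R.L 0 - (μ - n) • 1) := by
  refine LinearMap.ext fun x => ?_
  simp only [Module.End.mul_apply, LinearMap.sub_apply, LinearMap.smul_apply, Module.End.one_apply,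
    map_sub, map_smul, R.L_zero_apply_L n x, sub_smul]
  abel

/-- `L_n` maps the generalised `L_0`-eigenspace of eigenvalue `μ` into that of eigenvalue `μ - n`
(the grading of non-`L_0`-diagonalisable, e.g. staggered, modules).
[cite: KytolaRidout2009, §3 ("Lₘ maps the L₀ᵈ eigenspace of eigenvalue h to that of eigenvalue h - m")] -/
theorem apply_mem_maxGenEigenspace {μ : ℂ} {x : V} (hx : x ∈ (R.L 0).maxGenEigenspace μ) (n : ℤ) :
    R.L n x ∈ (R.L 0).maxGenEigenspace (μ - n) := by
  rw [Module.End.mem_maxGenEigenspace] at hx ⊢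
  obtain ⟨k, hk⟩ := hx
  refine ⟨k, ?_⟩
  have h2 := congrArg (fun f : Module.End ℂ V => f x) ((R.semiconjBy_L n μ).pow_right k).eq
  simp only [Module.End.mul_apply] at h2
  rw [← h2, hk, map_zero]

/-! ### Weight spaces, primary (highest-weight) vectors, singular vectors -/

/-- The `L_0`-weight space `V_μ = ker (L_0 - μ)`. [cite: KytolaRidout2009, §2 (before eq. (2.8))] -/
abbrev weightSpace (μ : ℂ) : Submodule ℂ V := (R.L 0).eigenspace μ

/-- The generalised `L_0`-weight space `⋃ₖ ker (L_0 - μ)ᵏ` (the grading by `L_0ᵈ`-eigenvalues used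
for modules on which `L_0` is not diagonalisable). [cite: KytolaRidout2009, §3] -/
abbrev genWeightSpace (μ : ℂ) : Submodule ℂ V := (R.L 0).maxGenEigenspace μ

/-- The **graded dimension** at weight `μ`: the dimension of the generalised weight space `V_μ`
(the coefficient of `q^μ` in the character `Tr q^{L_0}`; `Module.finrank`, so `0` is also returned
for an infinite-dimensional weight space). [cite: DiFrancescoMathieuSenechal1997, eq. (7.12)] -/
def gradedDim (μ : ℂ) : ℕ := Module.finrank ℂ (R.genWeightSpace μ)

/-- A **primary** (= highest-weight) **vector of weight `h`**: `L_n v = 0` for `n > 0` and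
`L_0 v = h v` ("an eigenvector of vir⁰ which is annihilated by vir⁺"; `v = 0` is allowed here, as in
the unitary structure `UnitaryVirasoroRep.IsPrimary`). [cite: KytolaRidout2009, §2]
[cite: DiFrancescoMathieuSenechal1997, eqs. (7.5)–(7.6)] -/
structure IsPrimary (v : V) (h : ℂ) : Prop where
  /-- Annihilation by the raising part `vir⁺`. -/
  annihilated : ∀ n : ℤ, 0 < n → R.L n v = 0
  /-- `L_0 v = h v`. -/
  weight : R.L 0 v = h • v

/-- The zero vector is (vacuously) primary of every weight. [folklore] -/
theorem isPrimary_zero (h : ℂ) : R.IsPrimary 0 h :=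
  ⟨fun n _ => map_zero _, by rw [map_zero, smul_zero]⟩

/-- A primary vector of weight `h` lies in the weight space `V_h`. [folklore] -/
theorem IsPrimary.mem_weightSpace {R : VirasoroRep c V} {v : V} {h : ℂ} (hv : R.IsPrimary v h) :
    v ∈ R.weightSpace h :=
  Module.End.mem_eigenspace_iff.mpr hv.weight

/-- `L_n L_{-n} v = (2nh + (c/12)(n³ - n)) v` for a primary `v` of weight `h` and `n > 0`.
[cite: DiFrancescoMathieuSenechal1997, eq. (7.19)] -/
theorem IsPrimary.L_pos_L_neg {R : VirasoroRep c V} {v : V} {h : ℂ} (hv : R.IsPrimary v h)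
    (n : ℤ) (hn : 0 < n) :
    R.L n (R.L (-n) v) = (2 * n * h + c / 12 * ((n : ℂ) ^ 3 - n)) • v := by
  rw [R.comm_apply n (-n) v, hv.annihilated n hn, map_zero, zero_add, add_neg_cancel, hv.weight,
    smul_smul, centralTerm_self_neg, ← add_smul]
  congr 1
  push_cast
  ring

/-- `L_0 L_{-n} v = (h + n) L_{-n} v` for a primary `v` of weight `h`.
[cite: DiFrancescoMathieuSenechal1997, eq. (7.8)] -/
theorem IsPrimary.L_zero_L_neg {R : VirasoroRep c V} {v : V} {h : ℂ} (hv : R.IsPrimary v h)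
    (n : ℤ) : R.L 0 (R.L (-n) v) = (h + n) • R.L (-n) v := by
  rw [R.L_zero_apply_L, hv.weight, map_smul, Int.cast_neg, neg_smul, sub_neg_eq_add, add_smul]

/-- The descendant `L_{-1} v` of a primary vector `v` of weight `h = 0` is again primary, of weight
`h + 1` (`L_1 L_{-1} v = 2h v = 0`): in `V(c, 0)` it is the level-one singular vector, which is
quotiented in `K_{1,1} = V_0/V_1` (the vacuum module: `L_{-1}|0⟩ = 0`).
[cite: DiFrancescoMathieuSenechal1997, eq. (7.19) (n = 1)] [cite: KytolaRidout2009, footnote 7 (H^L = V₀/V₁ at c = 0)] -/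
theorem IsPrimary.L_neg_one {R : VirasoroRep c V} {v : V} {h : ℂ} (hv : R.IsPrimary v h)
    (hh : h = 0) : R.IsPrimary (R.L (-1) v) (h + 1) := by
  refine ⟨fun n hn => ?_, by simpa using hv.L_zero_L_neg 1⟩
  rw [R.comm_apply n (-1) v, hv.annihilated n hn, map_zero, zero_add]
  rcases eq_or_lt_of_le (by omega : (1 : ℤ) ≤ n) with rfl | h1
  · simp [hv.weight, hh, centralTerm]
  · rw [hv.annihilated (n + -1) (by omega), smul_zero, zero_add, centralTerm_of_ne c (by omega),
      zero_smul]

/-- A **singular vector of level `N`** in a module of highest weight `h`: a NON-ZERO primary vector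
of weight `h + N` (mathematicians' convention: the generating highest-weight vector is singular of
level `0`). [cite: IoharaKoga2011, Definition 5.3] [cite: KytolaRidout2009, §2] -/
def IsSingularVector (v : V) (h : ℂ) (N : ℕ) : Prop :=
  v ≠ 0 ∧ R.IsPrimary v (h + N)

/-! ### Subrepresentations, generated subrepresentations, quotients -/

/-- A subspace `W` is **invariant** (a subrepresentation) if `L_n W ⊆ W` for all `n`. [folklore] -/
def IsInvariant (W : Submodule ℂ V) : Prop :=
  ∀ (n : ℤ), ∀ x ∈ W, R.L n x ∈ W

/-- The **subrepresentation generated by a set** `s`: the smallest invariant subspace containing `s`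
(for a single vector `w`, the space `U·w` of its descendants). [cite: KytolaRidout2009, §2 ("descendant")] -/
def generated (s : Set V) : Submodule ℂ V :=
  sInf {W : Submodule ℂ V | s ⊆ W ∧ R.IsInvariant W}

/-- `s ⊆ ⟨s⟩`. [folklore] -/
theorem subset_generated (s : Set V) : s ⊆ R.generated s := by
  intro x hx
  simp only [generated, SetLike.mem_coe, Submodule.mem_sInf, Set.mem_setOf_eq]
  exact fun W hW => hW.1 hx

/-- `⟨s⟩` is invariant. [folklore] -/
theorem isInvariant_generated (s : Set V) : R.IsInvariant (R.generated s) := by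
  intro n x hx
  simp only [generated, Submodule.mem_sInf, Set.mem_setOf_eq] at hx ⊢
  exact fun W hW => hW.2 n x (hx W hW)

/-- `⟨s⟩` is the least invariant subspace containing `s`. [folklore] -/
theorem generated_le {s : Set V} {W : Submodule ℂ V} (hs : s ⊆ W) (hW : R.IsInvariant W) :
    R.generated s ≤ W :=
  sInf_le ⟨hs, hW⟩

/-- `⟨·⟩` is monotone. [folklore] -/
theorem generated_mono {s t : Set V} (h : s ⊆ t) : R.generated s ≤ R.generated t :=
  R.generated_le (h.trans (R.subset_generated t)) (R.isInvariant_generated t)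

/-- The **restriction** of a representation to an invariant subspace. [folklore] -/
def restrict (W : Submodule ℂ V) (hW : R.IsInvariant W) : VirasoroRep c W where
  L n := (R.L n).restrict (hW n)
  lie m n x := by
    apply Subtype.ext
    simp only [LinearMap.restrict_apply, Submodule.coe_sub, Submodule.coe_add, Submodule.coe_smul]
    exact R.lie m n x

/-- The **quotient** of a representation by an invariant subspace. [folklore] -/
def quotient (W : Submodule ℂ V) (hW : R.IsInvariant W) : VirasoroRep c (V ⧸ W) where
  L n := W.mapQ W (R.L n) (hW n)
  lie m n x := by
    obtain ⟨z, rfl⟩ := Submodule.Quotient.mk_surjective W x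
    simp only [Submodule.mapQ_apply]
    rw [← Submodule.Quotient.mk_sub, R.lie, Submodule.Quotient.mk_add, Submodule.Quotient.mk_smul,
      Submodule.Quotient.mk_smul]

/-- The quotient generators on classes: `L_n [z] = [L_n z]`. [folklore] -/
@[simp] theorem quotient_L_mk (W : Submodule ℂ V) (hW : R.IsInvariant W) (n : ℤ) (z : V) :
    (R.quotient W hW).L n (Submodule.Quotient.mk z) = Submodule.Quotient.mk (R.L n z) := rfl

/-- A primary vector stays primary (of the same weight) in every quotient. [folklore] -/
theorem IsPrimary.mkQ {R : VirasoroRep c V} {v : V} {h : ℂ} (hv : R.IsPrimary v h)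
    (W : Submodule ℂ V) (hW : R.IsInvariant W) :
    (R.quotient W hW).IsPrimary (Submodule.Quotient.mk v) h := by
  refine ⟨fun n hn => ?_, ?_⟩
  · rw [quotient_L_mk, hv.annihilated n hn, Submodule.Quotient.mk_zero]
  · rw [quotient_L_mk, hv.weight, Submodule.Quotient.mk_smul]

/-- A **highest-weight module** (generated by the non-zero primary vector `v` of weight `h`):
`v ≠ 0`, `v` primary of weight `h`, and `V = U·v`.
[cite: IoharaKoga2011, Definition 1.16] [cite: KytolaRidout2009, §2] -/
def IsHighestWeightModule (v : V) (h : ℂ) : Prop :=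
  v ≠ 0 ∧ R.IsPrimary v h ∧ R.generated {v} = ⊤

/-- The subrepresentation generated by all primary vectors of a given weight `μ` (in a
highest-weight module of weight `h`: by the singular vectors of level `μ - h`; in a Verma module
these span at most a line, Iohara–Koga Prop. 5.1). [cite: IoharaKoga2011, §5.2.1, Proposition 5.1] -/
def primarySpan (μ : ℂ) : Submodule ℂ V :=
  R.generated {w | R.IsPrimary w μ}

/-! ### Weight modules, indecomposable and staggered modules -/

/-- `V` is a **weight module**: `L_0` is diagonalisable, i.e. its eigenvectors span `V` (true for
highest-weight modules, false for staggered ones). [cite: KytolaRidout2009, §2–§3] -/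
def IsWeightModule (R : VirasoroRep c V) : Prop :=
  (⨆ μ : ℂ, R.weightSpace μ) = ⊤

/-- `V` is **indecomposable**: non-zero and not the direct sum of two non-zero invariant subspaces
("modules which cannot be written as a direct sum of two (non-trivial) submodules").
[cite: KytolaRidout2009, §2 (first paragraph)] -/
def IsIndecomposable (R : VirasoroRep c V) : Prop :=
  Nontrivial V ∧ ∀ W₁ W₂ : Submodule ℂ V,
    R.IsInvariant W₁ → R.IsInvariant W₂ → IsCompl W₁ W₂ → W₁ = ⊥ ∨ W₂ = ⊥

/-- A (rank-two) **staggered module**: an indecomposable module `S` with an invariant subspace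
`H^L` (the left module) such that `H^L` and `S/H^L` (the right module) are highest-weight modules,
on which `L_0` is NOT diagonalisable, with Jordan cells of rank at most `2`
(`⋃ₖ ker (L_0 - μ)ᵏ = ker (L_0 - μ)²` for every `μ`).
[cite: KytolaRidout2009, §3, eq. (3.1) and the surrounding definition] -/
def IsStaggered (R : VirasoroRep c V) : Prop :=
  R.IsIndecomposable ∧ ¬ R.IsWeightModule ∧
    (∀ μ : ℂ, R.genWeightSpace μ = (R.L 0).genEigenspace μ 2) ∧
      ∃ (W : Submodule ℂ V) (hW : R.IsInvariant W),
        (∃ (v : W) (h : ℂ), (R.restrict W hW).IsHighestWeightModule v h) ∧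
          ∃ (v : V ⧸ W) (h : ℂ), (R.quotient W hW).IsHighestWeightModule v h

/-! ### PBW words -/

/-- The descendant `L_{-k₁} L_{-k₂} ⋯ L_{-k_j} v` of `v` along the word `[k₁, …, k_j]` (for a
partition written in decreasing order `k₁ ≥ ⋯ ≥ k_j ≥ 1` this is the PBW monomial
`e_𝕀 · v = L_{-n}^{r_n} ⋯ L_{-1}^{r_1} v`). [cite: IoharaKoga2011, eq. (4.17)]
[cite: KytolaRidout2009, §2 (PBW basis of V_{h,c})] -/
def pbwVector (l : List ℕ) (v : V) : V :=
  l.foldr (fun k w => R.L (-(k : ℤ)) w) v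

/-- Unfolding on the empty word. [folklore] -/
@[simp] theorem pbwVector_nil (v : V) : R.pbwVector [] v = v := rfl

/-- Unfolding on a non-empty word. [folklore] -/
@[simp] theorem pbwVector_cons (k : ℕ) (l : List ℕ) (v : V) :
    R.pbwVector (k :: l) v = R.L (-(k : ℤ)) (R.pbwVector l v) := rfl

/-- A word of total degree `N` raises the `L_0`-weight by `N`: `L_0 (e_𝕀 v) = (μ + |𝕀|) e_𝕀 v`.
[cite: DiFrancescoMathieuSenechal1997, eq. (7.8)] -/
theorem pbwVector_mem_weightSpace {μ : ℂ} {v : V} (hv : v ∈ R.weightSpace μ) (l : List ℕ) :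
    R.pbwVector l v ∈ R.weightSpace (μ + (l.sum : ℕ)) := by
  induction l with
  | nil => simpa using hv
  | cons k l ih =>
    rw [pbwVector_cons, List.sum_cons]
    have := R.apply_mem_eigenspace ih (-(k : ℤ))
    convert this using 2
    push_cast
    ring

/-- Descendants stay in any invariant subspace. [folklore] -/
theorem pbwVector_mem {W : Submodule ℂ V} (hW : R.IsInvariant W) {v : V} (hv : v ∈ W)
    (l : List ℕ) : R.pbwVector l v ∈ W := by
  induction l with
  | nil => simpa using hv
  | cons k l ih => exact hW _ _ ih

/-- The PBW monomial of a partition `𝕀 ⊢ N` (parts taken in decreasing order) applied to `v`.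
[cite: IoharaKoga2011, eq. (4.17)] -/
def partitionVector {N : ℕ} (p : N.Partition) (v : V) : V :=
  R.pbwVector (p.parts.sort (· ≤ ·)).reverse v

/-- `e_𝕀 v ∈ V_{μ+N}` for `𝕀 ⊢ N` and `v ∈ V_μ`. [cite: DiFrancescoMathieuSenechal1997, eq. (7.8)] -/
theorem partitionVector_mem_weightSpace {μ : ℂ} {v : V} (hv : v ∈ R.weightSpace μ) {N : ℕ}
    (p : N.Partition) : R.partitionVector p v ∈ R.weightSpace (μ + N) := by
  have h := R.pbwVector_mem_weightSpace hv (p.parts.sort (· ≤ ·)).reverse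
  have hs : ((p.parts.sort (· ≤ ·)).reverse).sum = N := by
    rw [List.sum_reverse, ← Multiset.sum_coe, Multiset.sort_eq, p.parts_sum]
  rwa [hs] at h

end VirasoroRep

end Literature.RepresentationTheory.Virasoro

end
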